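import Summits.ValiantsHypothesis.ValiantsHypothesis.Theorems.BarrierLeverPartitionMinorsHitByVPHiddenStatesBallCutClassificationCheck

/-!
# Route BarrierLever — item `PartitionMinorsHitByVP` (stmt-ValiantsHypothesis-19717), line `hidden-states`:
# THE CLASSIFICATION AT LEVEL t = 2 — segment 5/8 of the native check (computational lane `Lean.ofReduceBool`)

Helper file (`--supports stmt-ValiantsHypothesis-19717`, `--computational`; cell valiant-natproofs, 𝒟-side door (c), registered line
`Cruxes/PartitionMinorsHitByVP/Lines/hidden_states.lean` v10; prover seat val-np-p6 gen 22).  Closes NO item.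
ONE `native_decide`: entries 14600 … 18249 of the enumeration `enumSeq unbalancedTypes (budget 2)` (28 971 run-length type lists = ALL totally
unbalanced coordinate-type configurations of level-2 3-swap families, `…BallCutClassification`) pass `checkEntry` (if the rebuilt family is a
down-closed 3-swap family then the fast LU certificate passes at one of the seeds 7, 11, 13 modulo 65521).  Assembled in
`…ThirdShellLevelsLeTwo` (`checkAll_two` ⇒ S₃ at every t ≤ 2 for every h).  HONEST LABEL: computational lane; 19717 stays OPEN; nothing on crux
14610 or VP ≠ VNP.
-/

set_option linter.dupNamespace false

namespace Summit.ValiantsHypothesis.ValiantsHypothesis.Theorems.BarrierLever.HiddenStates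

namespace BallCut

/-- **Segment 5/8 of the level-2 classification check** (entries 14600 … 18249). -/
theorem checkAllSeg_two_4 : checkAllSeg unbalancedTypes 2 [7, 11, 13] 65521 14600 3650 = true := by
  native_decide

end BallCut

end Summit.ValiantsHypothesis.ValiantsHypothesis.Theorems.BarrierLever.HiddenStates
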